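import Summits.QuantumFields.YangMills.Theorems.UnitScaleTiltProp7HDsolAtRecordOfRows127
import Summits.QuantumFields.YangMills.Theorems.UnitScaleTiltProp7SectET3DeltaOneT3PInv
import Summits.QuantumFields.YangMills.Theorems.UnitScaleTiltProp7QkOntoOfRegPr
import Summits.QuantumFields.YangMills.Theorems.UnitScaleTiltProp7StubEXOfChartPiecesTwS
import Literature.MathematicalPhysics.QuantumFieldTheory.Balaban1983to89.T3PrintedMinimiserExistence
import HarnessLib

/-!
# Route `UnitScaleTilt`, crux «MinimiserStabilityRegPr» (stmt-QuantumFields-19200, stub EX `stub_existenceMinimalOrbit`), route (α) — **JUNCTION `hΔsol` AT THE FAMILY LEVEL, PINV LETTERS (v2):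
# THE DISPLAYED ROW `hΔsol` OF THE EX DISPLAY CANDIDATE S9′ (✓`Prop7StubEXOfChartPiecesTwS9P`, p670223) VERBATIM — (136)+(140) for `ιA₁ + ι(H₁B̃)` of THE solution of (111) at the letters of
# record Δ₁ᴾ (`frakGfR∕H1f … (DeltaOnePJ …) U₀`, ✓p668391) — FROM THE FOUR BACKGROUND-LEVEL ROWS {`hOpC′`, `h137₁`, `hOp139′₁`, `hOp349`} (★px5 g2 ✓p668120 «OP-ROWS-127», generic slot),
# ONE SOLUTION-LEVEL IDENTITY ROW `hmult` (print's (127) consequence — the Landau-constraint multiplier of (111)'s residual vanishes; cure of the located hazard №6 «hOpC-CZ», ★px5 #55),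
# the positivity row `hPos₁` ([B9] Thm 3.11 for `G₁`; onto ✓`surjective_Qk_of_regPr`), `norm_G prop4 norm_H₁`, and the knit's windows** (member theorem ★px16 g2 ✓p669325
# `Prop7HDsolAtRecordOfRows127.hΔsol_at_record_of_rows127`, generic slot, instantiated at Δ₁ᴾ with `hkill∕horth := DeltaOneP_kills_NS ∕ inner_DL2_DeltaOneP_eq_zero`), `MΔ L` EXPLICIT
# (twin of ✓`Prop7HDsolAtRecordOfRowsFamily` (p665617) at the classed slot — this is its repair of record).

Cell `ym3-torus`, width seat `ym-ust-19200-w2` (gen 6; EX knit lineage ∕ EX letter namer).  THEOREMS ONLY (0 `def`, 0 `sorry`); `--supports stmt-QuantumFields-19200 --as helper`, count-neutral.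
YM₃ on T³ is a ladder rung (R3), not the Clay problem; nothing here claims the stub, the crux, d = 4 or the mass gap.

THE ROWS (member texts = ✓p669325's binders VERBATIM under the family prefix): `hOpC′` — [B9] Thm 3.3 (n = 0) × `(QGQ*)⁻¹` × `Q` letters for the TUBE term `Q_k†(QGQ*)⁻¹Q_kG x` (generic `x`,
Pi-norm right side; η-free — the CZ projection term of (133) is NOT in it); `h137₁` — (137)'s block letter AT Δ₁ᴾ; `hOp139′₁` — the slot-defect row `‖toL2⁻¹(Δ^η X − Δ₁ᴾ X)‖ ≤ k139·s` on
Landau `X` ((138)–(139) + «`G′RD*` in |·|₍₁₎» + the J-term row; HONESTY CLAUSE of ✓p667715); `hOp349` — «`DPD*` bounded»; `hmult` — for THE solution's `x = Ĵ + Ŵ`,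
`D R_S D* G x = 0` ([Balaban1985Variational] (127): criticality on all of `ker Q` kills the multiplier — to be DERIVED from `hCrit93′ + hSplit′` by ★px21's lineage; displayed meanwhile).
INHABITABILITY (★★OWNER RULING g27-№9 (3)): four background-level rows true at the zero field, `K`-uniform constants = N06; `hmult` inhabited (e.g. the flat member) and print-derived;
`hPos₁` positivity only; `ha0`, `hWQ` numerics.  Everything else this door reads is S9′'s own (prefix, `norm_G prop4 norm_H₁`, `hrα hr4 hr16`, `hWe hWε`).

WHAT IS PROVED (ns `…Theorems.Prop7HDsolAtRecordOfRows127Family`).  ★★★`hΔsolP_of_opRows127_family` — S9′'s binder `hΔsol` quantifier for quantifier with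
`MΔ L := (1 + 25·C₄ L·B₀ L²) + cC L·(1 + 25·C₄ L·B₀ L²) + c137 L·2 + k139 L·(10 B₀ L)∕2 + 14·(10 B₀ L) + k349 L·(10 B₀ L)∕2 + 2·(10 B₀ L)`; the display's `hMΔ` numeric is ✓`Prop7HDsolAtRecordOfRowsFamily.hMΔ_of_nonneg` (landed).
HONEST SCOPE: by-name composition; the five rows, `hPos₁`, `norm_G prop4 norm_H₁` stay DISPLAYED; the opaque `Wf` untouched.

References: T. Bałaban, CMP 102 (1985) 277–309 [Balaban1985Variational] ((19) p.281, (111) p.294, Prop. 6 p.295, (127)–(140) pp.297–299); CMP 99 (1985) 389–434 [Balaban1985BackgroundPropagators]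
(Thm 3.3 p.396, Thm 3.11 p.418, (3.19) p.393, (3.49) p.399, (3.119)–(3.128) pp.419–421, (3.153) p.426).
-/

set_option autoImplicit false

noncomputable section

open scoped InnerProductSpace Matrix.Norms.L2Operator BigOperators

namespace Summit.QuantumFields.YangMills.Theorems.Prop7HDsolAtRecordOfRows127Family

open Literature.MathematicalPhysics.QuantumFieldTheory.Balaban1983to89
open Literature.MathematicalPhysics.QuantumFieldTheory.Balaban1983to89.T3ContinuumYM3Torus
open Literature.MathematicalPhysics.QuantumFieldTheory.Balaban1983to89.T3UnitLawDensityEML (ℰp)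
open Literature.MathematicalPhysics.QuantumFieldTheory.Balaban1983to89.T3TiltDescent (descendTo)
open Literature.MathematicalPhysics.QuantumFieldTheory.Balaban1983to89.T3Thm1Carrier (Idx)
open Literature.MathematicalPhysics.QuantumFieldTheory.Balaban1983to89.T3PrintedRegularMinimiser (RegPr)
open Literature.MathematicalPhysics.QuantumFieldTheory.Balaban1983to89.T3PrintedMinimiserExistence (regPr_mono)
open Literature.MathematicalPhysics.QuantumFieldTheory.Balaban1983to89.T3SectALandauChart (CloseAvg eta bgUnits covGradT covCodiffCurlT covLapFormT)
open B9SectCLatticeCarrier (Bond)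
open B9Eq311L2Pairing (WL2)
open B11Eq115Space (NegSize Space115 JetSup NegSup)
open B11Eq111FrakG (nabla115)
open B11Eq98CurrentSlot (Jcur)
open B11Eq103H1Complex (BondL2K funEquiv)
open B13Contraction113 (QuadAnalytic)
open MatrixLog (mlog)
open Summit.QuantumFields.YangMills.Theorems.Prop7SectET3Transport (periodsT3 bgOfCfg bondEquiv)
open Summit.QuantumFields.YangMills.Theorems.Prop7SectET3HilbertLetters (W₂ frobEquiv toL2 toL2B DL2 DstarL2)
open Summit.QuantumFields.YangMills.Theorems.Prop7SectET3GaugeProjector (RS)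
open Summit.QuantumFields.YangMills.Theorems.Prop7SectET3WilsonHessian (DeltaEta)
open Summit.QuantumFields.YangMills.Theorems.Prop7SectET3CurvedPropagators (laplaceA Qk PosOnto GT KinvT H1f frakGfR)
open Summit.QuantumFields.YangMills.Theorems.Prop7SectET3DeltaPiPInv (DeltaPiSlotP H46P inner_DL2_DeltaPiP_eq_zero DeltaPiSlotP_kills_NS)
open Summit.QuantumFields.YangMills.Theorems.Prop7SectET3DeltaOnePInv (DeltaOnePJ DeltaOneP_kills_NS inner_DL2_DeltaOneP_eq_zero)
open Summit.QuantumFields.YangMills.Theorems.Prop7QkOntoOfRegPr (surjective_Qk_of_regPr)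
open Summit.QuantumFields.YangMills.Theorems.Prop7StubEXOfChartPiecesTwS (windows_of_W)
open Summit.QuantumFields.YangMills.Theorems.Prop7StubEXOfChartPiecesTwL (windows_of_admissible three_le_memberL)
open Summit.QuantumFields.YangMills.Theorems.Prop7HDsolAtRecordOfRows127 (hΔsol_at_record_of_rows127)

variable [hFL : ∀ F : T3Family, Fact (0 < (F.L : ℝ))] [hFη : ∀ (F : T3Family) (k : ℕ), Fact (0 < ((F.L : ℝ)⁻¹) ^ k)]
variable {α : ℕ → ℝ} {c₀ cB : ℕ → ℝ} [hc₀ : ∀ L : ℕ, Fact (0 < c₀ L)] [hcB : ∀ L : ℕ, Fact (0 < cB L)] {a : ∀ L : ℕ, Idx L → ℝ}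
  {ef B₀ C₄ a₃ r cC c137 k139 k349 : ℕ → ℝ}

/-- ★★★ **S9′'s ROW `hΔsol` AT THE LETTERS OF RECORD Δ₁ᴾ, FAMILY LEVEL, VERBATIM — FROM THE FOUR OPERATOR ROWS, `hmult`, `hPos₁`, `norm_G prop4 norm_H₁` AND THE KNIT'S WINDOWS**, `MΔ L` explicit
(✓`hΔsol_at_record_of_rows127` at each member with `Δx := DeltaOnePJ …`).
[cite: Balaban1985Variational, (127)–(136) pp.297–298, (140) p.299, (19)–(20) p.281, (111) p.294, Prop. 6 p.295; Balaban1985BackgroundPropagators, Thm 3.3 p.396, Thm 3.11 p.418, (3.19) p.393, (3.49) p.399, (3.128) p.421, (3.153) p.426] -/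
theorem hΔsolP_of_opRows127_family (hα : ∀ L, 1 < L → 0 < α L) (hef : ∀ L, 1 < L → 0 < ef L)
    (hWe : ∀ L : ℕ, 1 < L → 10 ^ 9 * (L : ℝ) ^ 2 * ef L ≤ 1) (hWε : ∀ L : ℕ, 1 < L → 10 ^ 12 * (L : ℝ) ^ 3 * α L ≤ 1)
    (hWQ : ∀ L : ℕ, 1 < L → 13 * 10 ^ 14 * (L : ℝ) ^ 3 * α L ≤ 1)
    (hB₀ : ∀ L, 1 < L → 0 < B₀ L) (hC₄ : ∀ L, 1 < L → 0 < C₄ L) (ha0 : ∀ (L : ℕ) (i : Idx L), 0 ≤ a L i)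
    (Wf : ∀ (L : ℕ) (i : Idx L) (U₀ : GaugeField (i.1.1.P i.1.2.2) 0 (Matrix.specialUnitaryGroup (Fin 2) ℂ)),
      Space115 (i.1.1.L : ℝ) (((i.1.1.L : ℝ)⁻¹) ^ (i.1.2.2 - i.1.2.1)) (fun _ : Bond 3 (periodsT3 i.1.1 i.1.2.2) => i.1.2.2 - i.1.2.1)
          (fun _ : Bond 3 (periodsT3 i.1.1 i.1.2.2) × Fin 3 => i.1.2.2 - i.1.2.1) (nabla115 (((i.1.1.L : ℝ)⁻¹) ^ (i.1.2.2 - i.1.2.1)) (bgOfCfg i.1.1 i.1.2.2 U₀)) →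
        NegSize (i.1.1.L : ℝ) (((i.1.1.L : ℝ)⁻¹) ^ (i.1.2.2 - i.1.2.1)) (fun _ : Bond 3 (periodsT3 i.1.1 i.1.2.2) => i.1.2.2 - i.1.2.1) 3 (Matrix (Fin 2) (Fin 2) ℂ))
    (hPos₁ : ∀ (L : ℕ), 1 < L → ∀ (i : Idx L) (U₀ : GaugeField (i.1.1.P i.1.2.2) 0 (Matrix.specialUnitaryGroup (Fin 2) ℂ)), RegPr i.1.1 i.1.2.1 i.1.2.2 (α L) U₀ →
      ∀ x : BondL2K ℂ 3 (periodsT3 i.1.1 i.1.2.2) (c₀ L) W₂, x ≠ 0 →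
        0 < RCLike.re ⟪x, laplaceA i.1.1 i.1.2.1 i.1.2.2 i.2.2.le (c₀ L) (cB L) (a L i) (DeltaOnePJ i.1.1 i.1.2.1 i.1.2.2 i.2.2.le (c₀ L) (cB L) (a L i)) U₀ x⟫_ℂ)
    (norm_G : ∀ (L : ℕ), 1 < L → ∀ (i : Idx L) (ρ : ℝ) (U₀ : GaugeField (i.1.1.P i.1.2.2) 0 (Matrix.specialUnitaryGroup (Fin 2) ℂ)),
      RegPr i.1.1 i.1.2.1 i.1.2.2 ρ U₀ → ρ ≤ α L → ∀ f, ‖frakGfR i.1.1 i.1.2.1 i.1.2.2 i.2.2.le (c₀ L) (cB L) (a L i) (DeltaOnePJ i.1.1 i.1.2.1 i.1.2.2 i.2.2.le (c₀ L) (cB L) (a L i)) U₀ f‖ ≤ B₀ L * ‖f‖)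
    (prop4 : ∀ (L : ℕ), 1 < L → ∀ (i : Idx L) (ρ : ℝ) (U₀ : GaugeField (i.1.1.P i.1.2.2) 0 (Matrix.specialUnitaryGroup (Fin 2) ℂ)),
      RegPr i.1.1 i.1.2.1 i.1.2.2 ρ U₀ → ρ ≤ α L → QuadAnalytic (Wf L i U₀) (C₄ L) (a₃ L))
    (norm_H₁ : ∀ (L : ℕ), 1 < L → ∀ (i : Idx L) (ρ : ℝ) (U₀ : GaugeField (i.1.1.P i.1.2.2) 0 (Matrix.specialUnitaryGroup (Fin 2) ℂ)),
      RegPr i.1.1 i.1.2.1 i.1.2.2 ρ U₀ → ρ ≤ α L → ∀ b, ‖H1f i.1.1 i.1.2.1 i.1.2.2 i.2.2.le (c₀ L) (cB L) (a L i) (DeltaOnePJ i.1.1 i.1.2.1 i.1.2.2 i.2.2.le (c₀ L) (cB L) (a L i)) U₀ b‖ ≤ B₀ L * ‖b‖)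
    (hrα : ∀ L : ℕ, 1 < L → 2 * B₀ L * α L ≤ r L) (hr4 : ∀ L : ℕ, 1 < L → 4 * r L ≤ a₃ L) (hr16 : ∀ L : ℕ, 1 < L → 16 * B₀ L * C₄ L * r L ≤ 1)
    (hOpC : ∀ (L : ℕ), 1 < L → ∀ (i : Idx L) (U₀ : GaugeField (i.1.1.P i.1.2.2) 0 (Matrix.specialUnitaryGroup (Fin 2) ℂ)), RegPr i.1.1 i.1.2.1 i.1.2.2 (α L) U₀ →
      ∀ (x : BondL2K ℂ 3 (periodsT3 i.1.1 i.1.2.2) (c₀ L) W₂) (bd : PBond (i.1.1.P i.1.2.2) 0),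
        ‖(toL2 i.1.1 i.1.2.2 (c₀ L)).symm (LinearMap.adjoint (Qk i.1.1 i.1.2.1 i.1.2.2 i.2.2.le (c₀ L) (cB L) U₀) (KinvT i.1.1 i.1.2.1 i.1.2.2 i.2.2.le (c₀ L) (cB L) (a L i) (DeltaOnePJ i.1.1 i.1.2.1 i.1.2.2 i.2.2.le (c₀ L) (cB L) (a L i)) U₀ (Qk i.1.1 i.1.2.1 i.1.2.2 i.2.2.le (c₀ L) (cB L) U₀ (GT i.1.1 i.1.2.1 i.1.2.2 i.2.2.le (c₀ L) (cB L) (a L i) (DeltaOnePJ i.1.1 i.1.2.1 i.1.2.2 i.2.2.le (c₀ L) (cB L) (a L i)) U₀ x)))) bd‖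
          ≤ cC L * ‖(toL2 i.1.1 i.1.2.2 (c₀ L)).symm x‖)
    (h137 : ∀ (L : ℕ), 1 < L → ∀ (i : Idx L) (U₀ : GaugeField (i.1.1.P i.1.2.2) 0 (Matrix.specialUnitaryGroup (Fin 2) ℂ)), RegPr i.1.1 i.1.2.1 i.1.2.2 (α L) U₀ →
      ∀ (Y : PBond (i.1.1.P i.1.2.1) 0 → Matrix (Fin 2) (Fin 2) ℂ) (b : PBond (i.1.1.P i.1.2.2) 0),
        ‖(toL2 i.1.1 i.1.2.2 (c₀ L)).symm (LinearMap.adjoint (Qk i.1.1 i.1.2.1 i.1.2.2 i.2.2.le (c₀ L) (cB L) U₀) (KinvT i.1.1 i.1.2.1 i.1.2.2 i.2.2.le (c₀ L) (cB L) (a L i) (DeltaOnePJ i.1.1 i.1.2.1 i.1.2.2 i.2.2.le (c₀ L) (cB L) (a L i)) U₀ (toL2B i.1.1 i.1.2.1 (cB L) Y))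
            - LinearMap.adjoint (Qk i.1.1 i.1.2.1 i.1.2.2 i.2.2.le (c₀ L) (cB L) U₀) (((a L i : ℂ)) • toL2B i.1.1 i.1.2.1 (cB L) Y)) b‖ ≤ c137 L * ‖Y‖)
    (hOp139 : ∀ (L : ℕ), 1 < L → ∀ (i : Idx L) (U₀ : GaugeField (i.1.1.P i.1.2.2) 0 (Matrix.specialUnitaryGroup (Fin 2) ℂ)), RegPr i.1.1 i.1.2.1 i.1.2.2 (α L) U₀ →
      ∀ (X : PBond (i.1.1.P i.1.2.2) 0 → Matrix (Fin 2) (Fin 2) ℂ) (s : ℝ), RS i.1.1 i.1.2.1 i.1.2.2 i.2.2.le (c₀ L) (cB L) U₀ (DstarL2 i.1.1 i.1.2.1 i.1.2.2 (c₀ L) U₀ (toL2 i.1.1 i.1.2.2 (c₀ L) X)) = 0 → (∀ bd, ‖X bd‖ ≤ s) →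
        ∀ bd : PBond (i.1.1.P i.1.2.2) 0, ‖(toL2 i.1.1 i.1.2.2 (c₀ L)).symm (DeltaEta i.1.1 i.1.2.1 i.1.2.2 (c₀ L) U₀ (toL2 i.1.1 i.1.2.2 (c₀ L) X) - (DeltaOnePJ i.1.1 i.1.2.1 i.1.2.2 i.2.2.le (c₀ L) (cB L) (a L i)) U₀ (toL2 i.1.1 i.1.2.2 (c₀ L) X)) bd‖ ≤ k139 L * s)
    (hOp349 : ∀ (L : ℕ), 1 < L → ∀ (i : Idx L) (U₀ : GaugeField (i.1.1.P i.1.2.2) 0 (Matrix.specialUnitaryGroup (Fin 2) ℂ)), RegPr i.1.1 i.1.2.1 i.1.2.2 (α L) U₀ →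
      ∀ (X : PBond (i.1.1.P i.1.2.2) 0 → Matrix (Fin 2) (Fin 2) ℂ) (s : ℝ), (∀ bd, ‖X bd‖ ≤ s) → ∀ bd : PBond (i.1.1.P i.1.2.2) 0,
        ‖(toL2 i.1.1 i.1.2.2 (c₀ L)).symm (DL2 i.1.1 i.1.2.1 i.1.2.2 (c₀ L) U₀ (DstarL2 i.1.1 i.1.2.1 i.1.2.2 (c₀ L) U₀ (toL2 i.1.1 i.1.2.2 (c₀ L) X) - RS i.1.1 i.1.2.1 i.1.2.2 i.2.2.le (c₀ L) (cB L) U₀ (DstarL2 i.1.1 i.1.2.1 i.1.2.2 (c₀ L) U₀ (toL2 i.1.1 i.1.2.2 (c₀ L) X)))) bd‖ ≤ k349 L * s)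
    (hmult : ∀ (L : ℕ), 1 < L → ∀ (i : Idx L) (ε₁ : ℝ) (V : GaugeField (i.1.1.P i.1.2.1) 0 (Matrix.specialUnitaryGroup (Fin 2) ℂ))
      (U₀ : GaugeField (i.1.1.P i.1.2.2) 0 (Matrix.specialUnitaryGroup (Fin 2) ℂ)), 0 < ε₁ → PlaqSmall ε₁ V →
      RegPr i.1.1 i.1.2.1 i.1.2.2 ((L : ℝ) ^ 3 * (3 * (L : ℝ)) * ε₁) U₀ → CloseAvg i.1.1 i.1.2.1 i.1.2.2 i.2.2.le ((L : ℝ) ^ 3 * ε₁) V U₀ → (L : ℝ) ^ 3 * (3 * (L : ℝ)) * ε₁ ≤ α L →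
      ∀ A₁ : Space115 (i.1.1.L : ℝ) (((i.1.1.L : ℝ)⁻¹) ^ (i.1.2.2 - i.1.2.1)) (fun _ : Bond 3 (periodsT3 i.1.1 i.1.2.2) => i.1.2.2 - i.1.2.1)
          (fun _ : Bond 3 (periodsT3 i.1.1 i.1.2.2) × Fin 3 => i.1.2.2 - i.1.2.1) (nabla115 (((i.1.1.L : ℝ)⁻¹) ^ (i.1.2.2 - i.1.2.1)) (bgOfCfg i.1.1 i.1.2.2 U₀)),
        ‖A₁‖ < r L →
        A₁ + frakGfR i.1.1 i.1.2.1 i.1.2.2 i.2.2.le (c₀ L) (cB L) (a L i) (DeltaOnePJ i.1.1 i.1.2.1 i.1.2.2 i.2.2.le (c₀ L) (cB L) (a L i)) U₀ (Jcur (bgOfCfg i.1.1 i.1.2.2 U₀)) + frakGfR i.1.1 i.1.2.1 i.1.2.2 i.2.2.le (c₀ L) (cB L) (a L i) (DeltaOnePJ i.1.1 i.1.2.1 i.1.2.2 i.2.2.le (c₀ L) (cB L) (a L i)) U₀ (Wf L i U₀ (A₁ + H1f i.1.1 i.1.2.1 i.1.2.2 i.2.2.le (c₀ L) (cB L) (a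 L i) (DeltaOnePJ i.1.1 i.1.2.1 i.1.2.2 i.2.2.le (c₀ L) (cB L) (a L i)) U₀ (fun c : PBond (i.1.1.P i.1.2.1) 0 =>
          (-Complex.I) • mlog (((V c : Matrix.specialUnitaryGroup (Fin 2) ℂ) : Matrix (Fin 2) (Fin 2) ℂ)
            * star ((descendTo i.1.1 ℰp i.1.2.1 i.1.2.2 i.2.2.le U₀ c : Matrix.specialUnitaryGroup (Fin 2) ℂ) : Matrix (Fin 2) (Fin 2) ℂ))))) = 0 →
        DL2 i.1.1 i.1.2.1 i.1.2.2 (c₀ L) U₀ (RS i.1.1 i.1.2.1 i.1.2.2 i.2.2.le (c₀ L) (cB L) U₀ (DstarL2 i.1.1 i.1.2.1 i.1.2.2 (c₀ L) U₀ (GT i.1.1 i.1.2.1 i.1.2.2 i.2.2.le (c₀ L) (cB L) (a L i) (DeltaOnePJ i.1.1 i.1.2.1 i.1.2.2 i.2.2.le (c₀ L) (cB L) (a L i)) U₀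
        ((funEquiv frobEquiv (fun _ : Bond 3 (periodsT3 i.1.1 i.1.2.2) => c₀ L)).symm
          (NegSup.equiv _ _ (Jcur (L := (i.1.1.L : ℝ)) (η := ((i.1.1.L : ℝ)⁻¹) ^ (i.1.2.2 - i.1.2.1)) (lev₀ := fun _ : Bond 3 (periodsT3 i.1.1 i.1.2.2) => i.1.2.2 - i.1.2.1) (bgOfCfg i.1.1 i.1.2.2 U₀))
            + NegSup.equiv _ _ (Wf L i U₀ (A₁ + H1f i.1.1 i.1.2.1 i.1.2.2 i.2.2.le (c₀ L) (cB L) (a L i) (DeltaOnePJ i.1.1 i.1.2.1 i.1.2.2 i.2.2.le (c₀ L) (cB L) (a L i)) U₀ (fun c : PBond (i.1.1.P i.1.2.1) 0 =>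
            (-Complex.I) • mlog (((V c : Matrix.specialUnitaryGroup (Fin 2) ℂ) : Matrix (Fin 2) (Fin 2) ℂ)
              * star ((descendTo i.1.1 ℰp i.1.2.1 i.1.2.2 i.2.2.le U₀ c : Matrix.specialUnitaryGroup (Fin 2) ℂ) : Matrix (Fin 2) (Fin 2) ℂ)))))))))) = 0) :
    ∀ (L : ℕ), 1 < L → ∀ (i : Idx L) (ε₁ : ℝ) (V : GaugeField (i.1.1.P i.1.2.1) 0 (Matrix.specialUnitaryGroup (Fin 2) ℂ))
      (U₀ : GaugeField (i.1.1.P i.1.2.2) 0 (Matrix.specialUnitaryGroup (Fin 2) ℂ)), 0 < ε₁ → PlaqSmall ε₁ V →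
      RegPr i.1.1 i.1.2.1 i.1.2.2 ((L : ℝ) ^ 3 * (3 * (L : ℝ)) * ε₁) U₀ → CloseAvg i.1.1 i.1.2.1 i.1.2.2 i.2.2.le ((L : ℝ) ^ 3 * ε₁) V U₀ → (L : ℝ) ^ 3 * (3 * (L : ℝ)) * ε₁ ≤ α L →
      ∀ A₁ : Space115 (i.1.1.L : ℝ) (((i.1.1.L : ℝ)⁻¹) ^ (i.1.2.2 - i.1.2.1)) (fun _ : Bond 3 (periodsT3 i.1.1 i.1.2.2) => i.1.2.2 - i.1.2.1)
          (fun _ : Bond 3 (periodsT3 i.1.1 i.1.2.2) × Fin 3 => i.1.2.2 - i.1.2.1) (nabla115 (((i.1.1.L : ℝ)⁻¹) ^ (i.1.2.2 - i.1.2.1)) (bgOfCfg i.1.1 i.1.2.2 U₀)),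
        ‖A₁‖ < r L →
        A₁ + frakGfR i.1.1 i.1.2.1 i.1.2.2 i.2.2.le (c₀ L) (cB L) (a L i) (DeltaOnePJ i.1.1 i.1.2.1 i.1.2.2 i.2.2.le (c₀ L) (cB L) (a L i)) U₀ (Jcur (bgOfCfg i.1.1 i.1.2.2 U₀)) + frakGfR i.1.1 i.1.2.1 i.1.2.2 i.2.2.le (c₀ L) (cB L) (a L i) (DeltaOnePJ i.1.1 i.1.2.1 i.1.2.2 i.2.2.le (c₀ L) (cB L) (a L i)) U₀ (Wf L i U₀ (A₁ + H1f i.1.1 i.1.2.1 i.1.2.2 i.2.2.le (c₀ L) (cB L) (a L i) (DeltaOnePJ i.1.1 i.1.2.1 i.1.2.2 i.2.2.le (c₀ L) (cB L) (a L i)) U₀ (fun c : PBond (i.1.1.P i.1.2.1) 0 =>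
          (-Complex.I) • mlog (((V c : Matrix.specialUnitaryGroup (Fin 2) ℂ) : Matrix (Fin 2) (Fin 2) ℂ)
            * star ((descendTo i.1.1 ℰp i.1.2.1 i.1.2.2 i.2.2.le U₀ c : Matrix.specialUnitaryGroup (Fin 2) ℂ) : Matrix (Fin 2) (Fin 2) ℂ))))) = 0 →
        (∀ (μ : Fin (i.1.1.P i.1.2.2).d) (x : Site (i.1.1.P i.1.2.2) 0),
            ‖covCodiffCurlT 1 (bgUnits i.1.1 i.1.2.2 U₀) ((fun b : PBond (i.1.1.P i.1.2.2) 0 => JetSup.equiv _ _ _ A₁ (bondEquiv i.1.1 i.1.2.2 b))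
            + (fun b : PBond (i.1.1.P i.1.2.2) 0 => JetSup.equiv _ _ _ (H1f i.1.1 i.1.2.1 i.1.2.2 i.2.2.le (c₀ L) (cB L) (a L i) (DeltaOnePJ i.1.1 i.1.2.1 i.1.2.2 i.2.2.le (c₀ L) (cB L) (a L i)) U₀ (fun c : PBond (i.1.1.P i.1.2.1) 0 =>
          (-Complex.I) • mlog (((V c : Matrix.specialUnitaryGroup (Fin 2) ℂ) : Matrix (Fin 2) (Fin 2) ℂ)
            * star ((descendTo i.1.1 ℰp i.1.2.1 i.1.2.2 i.2.2.le U₀ c : Matrix.specialUnitaryGroup (Fin 2) ℂ) : Matrix (Fin 2) (Fin 2) ℂ)))) (bondEquiv i.1.1 i.1.2.2 b))) μ x‖ ≤ ((1 + 25 * C₄ L * B₀ L ^ 2) + cC L * (1 + 25 * C₄ L * B₀ L ^ 2) + c137 L * 2 + k139 L * (10 * B₀ L) / 2 + 14 * (10 * B₀ L) + k349 L * (10 * B₀ L) / 2 + 2 * (10 * B₀ L)) * ((L : ℝ) ^ 3 * (3 * (L : ℝ)) * ε₁) * eta i.1.1 i.1.2.1 i.1.2.2 ^ 2) ∧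
          (∀ (ν : Fin (i.1.1.P i.1.2.2).d) (x : Site (i.1.1.P i.1.2.2) 0),
            ‖covLapFormT 1 (bgUnits i.1.1 i.1.2.2 U₀) ((fun b : PBond (i.1.1.P i.1.2.2) 0 => JetSup.equiv _ _ _ A₁ (bondEquiv i.1.1 i.1.2.2 b))
            + (fun b : PBond (i.1.1.P i.1.2.2) 0 => JetSup.equiv _ _ _ (H1f i.1.1 i.1.2.1 i.1.2.2 i.2.2.le (c₀ L) (cB L) (a L i) (DeltaOnePJ i.1.1 i.1.2.1 i.1.2.2 i.2.2.le (c₀ L) (cB L) (a L i)) U₀ (fun c : PBond (i.1.1.P i.1.2.1) 0 =>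
          (-Complex.I) • mlog (((V c : Matrix.specialUnitaryGroup (Fin 2) ℂ) : Matrix (Fin 2) (Fin 2) ℂ)
            * star ((descendTo i.1.1 ℰp i.1.2.1 i.1.2.2 i.2.2.le U₀ c : Matrix.specialUnitaryGroup (Fin 2) ℂ) : Matrix (Fin 2) (Fin 2) ℂ)))) (bondEquiv i.1.1 i.1.2.2 b))) ν x‖ ≤ ((1 + 25 * C₄ L * B₀ L ^ 2) + cC L * (1 + 25 * C₄ L * B₀ L ^ 2) + c137 L * 2 + k139 L * (10 * B₀ L) / 2 + 14 * (10 * B₀ L) + k349 L * (10 * B₀ L) / 2 + 2 * (10 * B₀ L)) * ((L : ℝ) ^ 3 * (3 * (L : ℝ)) * ε₁) * eta i.1.1 i.1.2.1 i.1.2.2 ^ 2) := by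
  intro L hL i ε₁ V U₀ hε₁ hV hreg hclose hαe A₁ hA₁ hsol
  have hFL' : (i.1.1.L : ℝ) = (L : ℝ) := by exact_mod_cast i.2.1
  have hL1 : (1 : ℝ) ≤ (L : ℝ) := by exact_mod_cast hL.le
  have hL3 : (3 : ℝ) ≤ (L : ℝ) := by rw [← hFL']; exact three_le_memberL i
  obtain ⟨s3, -⟩ := windows_of_W hL3 (hα L hL).le (hef L hL).le (hWe L hL) (hWε L hL)
  obtain ⟨hwinL, -, hα16⟩ := windows_of_admissible hL1 hε₁.le hαe s3
  have hregα : RegPr i.1.1 i.1.2.1 i.1.2.2 (α L) U₀ := regPr_mono i.1.1 hαe hreg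
  have hWQ' : 13 * 10 ^ 14 * (i.1.1.L : ℝ) ^ 3 * α L ≤ 1 := by rw [hFL']; exact hWQ L hL
  have hp : PosOnto i.1.1 i.1.2.1 i.1.2.2 i.2.2.le (c₀ L) (cB L) (a L i) (DeltaOnePJ i.1.1 i.1.2.1 i.1.2.2 i.2.2.le (c₀ L) (cB L) (a L i)) U₀ :=
    ⟨hPos₁ L hL i U₀ hregα, surjective_Qk_of_regPr i.1.1 i.2.2.le i.2.2 (c₀ L) (cB L) hregα hWQ'⟩
  have hreg' : RegPr i.1.1 i.1.2.1 i.1.2.2 ((i.1.1.L : ℝ) ^ 3 * (3 * (i.1.1.L : ℝ)) * ε₁) U₀ := by rw [hFL']; exact hreg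
  have hclose' : CloseAvg i.1.1 i.1.2.1 i.1.2.2 i.2.2.le ((i.1.1.L : ℝ) ^ 3 * ε₁) V U₀ := by rw [hFL']; exact hclose
  have hwin : (i.1.1.L : ℝ) ^ 3 * ε₁ ≤ 1 / 2 := by rw [hFL']; exact hwinL
  have hρ1 : (i.1.1.L : ℝ) ^ 3 * (3 * (i.1.1.L : ℝ)) * ε₁ ≤ 1 := by rw [hFL']; linarith
  have hB0 : 0 < B₀ L := hB₀ L hL
  have hρα : (i.1.1.L : ℝ) ^ 3 * (3 * (i.1.1.L : ℝ)) * ε₁ ≤ α L := by rw [hFL']; exact hαe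
  have h1 : 2 * B₀ L * (i.1.1.L : ℝ) ^ 3 * (3 * (i.1.1.L : ℝ)) * ε₁ ≤ r L := by
    nlinarith [hrα L hL, mul_le_mul_of_nonneg_left hρα hB0.le]
  have hmem := hΔsol_at_record_of_rows127 i.1.1 i.1.2.1 i.1.2.2 i.2.2.le U₀ V (Wf L i U₀) hB0 (hC₄ L hL) hε₁ hreg' hclose' hwin hρ1 hp
    (DeltaOneP_kills_NS _ (ha0 L i)) (inner_DL2_DeltaOneP_eq_zero _ (ha0 L i))
    (norm_G L hL i _ U₀ hreg hαe) (prop4 L hL i _ U₀ hreg hαe) (norm_H₁ L hL i _ U₀ hreg hαe) h1 (hr4 L hL) (hr16 L hL)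
    (hOpC L hL i U₀ hregα) (h137 L hL i U₀ hregα) (hOp139 L hL i U₀ hregα) (hOp349 L hL i U₀ hregα) A₁ hA₁ hsol
    (hmult L hL i ε₁ V U₀ hε₁ hV hreg hclose hαe A₁ hA₁ hsol)
  refine ⟨fun μ x => (hmem.1 μ x).trans_eq ?_, fun ν x => (hmem.2 ν x).trans_eq ?_⟩ <;> rw [hFL']

end Summit.QuantumFields.YangMills.Theorems.Prop7HDsolAtRecordOfRows127Family

end
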